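import Literature.NumberTheory.Automorphic.QuaternionLocalSplitIdealCount
import Literature.NumberTheory.Automorphic.QuaternionLocalEulerFactor
import Mathlib.LinearAlgebra.Matrix.GeneralLinearGroup.Card
import HarnessLib

/-!
# The maximal order at a split prime: `|O₍ₚ₎ˣ mod p| = |GL₂(𝔽_p)|` and the decay of the
# norm-level complement

Topic `NumberTheory/Automorphic`; theorems only (no definition, no named fact, no instance).
For a `ℤ`-order `O` of a definite quaternion algebra `B` over `ℚ` with a matrix model
`O₍ₚ₎ = Ψ⁻¹(M₂(ℤ_p))` at the prime `p` (`QuaternionLocalSplit.lean`: every maximal order at a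
split prime), reduction of `Ψ` modulo `p` identifies `O₍ₚ₎ / p O₍ₚ₎` with `M₂(𝔽_p)`
(Vignéras, LNM 800, Ch. II §2: `O_p ≅ M₂(ℤ_p)`), whence

* `ncard_image_stabilizer_of_split` — **`|O₍ₚ₎ˣ mod p O₍ₚ₎| = |GL₂(𝔽_p)| = (p² - 1)(p² - p)`**
  (Mathlib `Matrix.card_GL_field`);
* `tendsto_density_normLevel_compl_of_split` — **the density `|Y_R mod p^R| / p^{4R}` of the
  complement of the norm levels `X_k`, `k < R`, tends to `0`**: by the partial-sum identity of
  `QuaternionLocalEulerFactor.lean`, `|Y_R mod p^R| / p^{4R} = 1 - (u_p / p⁴) ∑_{k<R} a(p^k) p^{-2k}`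
  with `u_p = |GL₂(𝔽_p)|` and `a(p^k) = 1 + p + ⋯ + p^k` (`card_principal_ideals_of_split`),
  and `∑_k σ₁(p^k) p^{-2k} = 1 / ((1 - p⁻¹)(1 - p⁻²)) = p⁴ / |GL₂(𝔽_p)|`
  (`hasSum_sigma_one_div_pow`).

These are the local inputs at the primes `p ∤ N⁺ N⁻`, and (through `O₍ₚ₎ ⊆ O₁,₍ₚ₎`) half of
the input at `p ∣ N⁺`, of the unit-density computation of Eichler's mass formula
(`brandtModule_massFormula`; Voight §26.4, Lemma 26.6.7).

## References

* M.-F. Vignéras, *Arithmétique des algèbres de quaternions*, LNM 800 (1980), Ch. II §2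
  Thm. 2.3, Ch. V §2 [VignerasLNM800].
* J. Voight, *Quaternion Algebras*, GTM 288 (2021), §26.4, Lemma 26.6.7, (25.3.7).
-/

noncomputable section

open scoped TensorProduct Pointwise Matrix Topology BigOperators
open Filter Finset

universe u

namespace Literature.NumberTheory.Automorphic

/-! ### Counting residues through a map with the same fibres -/

section Fibres

variable {B : Type u} [AddCommGroup B]

/-- If a map `ρ` has the same fibres on `T` as the projection `B → B ⧸ K`, then `T` has as many
residues modulo `K` as `ρ`-values. [folklore] -/
theorem ncard_image_mk_eq_ncard_image {K : AddSubgroup B} {T : Set B} {γ : Type*} (ρ : B → γ)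
    (h : ∀ x ∈ T, ∀ y ∈ T, ((QuotientAddGroup.mk x : B ⧸ K) = QuotientAddGroup.mk y ↔ ρ x = ρ y)) :
    (QuotientAddGroup.mk '' T : Set (B ⧸ K)).ncard = (ρ '' T).ncard := by
  classical
  refine Set.ncard_congr (fun q hq => ρ ((Set.mem_image _ _ _).mp hq).choose) ?_ ?_ ?_
  · intro q hq
    exact ⟨_, ((Set.mem_image _ _ _).mp hq).choose_spec.1, rfl⟩
  · intro q q' hq hq' heq
    have hx := ((Set.mem_image _ _ _).mp hq).choose_spec
    have hx' := ((Set.mem_image _ _ _).mp hq').choose_spec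
    rw [← hx.2, ← hx'.2]
    exact (h _ hx.1 _ hx'.1).mpr heq
  · rintro _ ⟨y, hy, rfl⟩
    refine ⟨QuotientAddGroup.mk y, ⟨y, hy, rfl⟩, ?_⟩
    have hc := ((Set.mem_image _ _ _).mp (⟨y, hy, rfl⟩ :
      (QuotientAddGroup.mk y : B ⧸ K) ∈ QuotientAddGroup.mk '' T)).choose_spec
    exact (h _ hc.1 _ hy).mp hc.2

end Fibres

/-! ### `p`-adic integers of norm `< 1` -/

section PadicIntHelpers

variable {p : ℕ} [hp : Fact p.Prime]

/-- For a `p`-adic integer: `‖z‖ < 1 ↔ ‖z‖ ≤ p⁻¹`. [folklore] -/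
theorem PadicInt.norm_lt_one_iff_norm_le_inv (z : ℤ_[p]) : ‖z‖ < 1 ↔ ‖z‖ ≤ (p : ℝ)⁻¹ := by
  rw [PadicInt.norm_lt_one_iff_dvd, ← Ideal.mem_span_singleton, ← pow_one (p : ℤ_[p]),
    ← PadicInt.norm_le_pow_iff_mem_span_pow, zpow_neg, zpow_natCast, pow_one]

/-- `toZMod z = 0 ↔ ‖z‖ < 1`. [folklore] -/
theorem PadicInt.toZMod_eq_zero_iff (z : ℤ_[p]) : PadicInt.toZMod z = 0 ↔ ‖z‖ < 1 := by
  rw [← RingHom.mem_ker, PadicInt.ker_toZMod, IsLocalRing.mem_maximalIdeal, PadicInt.mem_nonunits]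

/-- Two `p`-adic integers have the same reduction modulo `p` iff their difference has norm `< 1`.
[folklore] -/
theorem PadicInt.toZMod_eq_toZMod_iff (z w : ℤ_[p]) :
    PadicInt.toZMod z = PadicInt.toZMod w ↔ ‖z - w‖ < 1 := by
  rw [← sub_eq_zero, ← map_sub, PadicInt.toZMod_eq_zero_iff]

end PadicIntHelpers

/-! ### `|O₍ₚ₎ˣ mod p| = |GL₂(𝔽_p)|` -/

section UnitCount

variable {B : Type u} [Ring B] [Algebra ℚ B] [IsQuaternionAlgebra ℚ B] {p : ℕ} [hp : Fact p.Prime]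

/-- The number of invertible `2 × 2` matrices over `𝔽_p` is `(p² - 1)(p² - p)`
(Mathlib `Matrix.card_GL_field`). [folklore] -/
theorem ncard_det_ne_zero_zmod :
    ({M : Matrix (Fin 2) (Fin 2) (ZMod p) | M.det ≠ 0} : Set _).ncard = (p ^ 2 - 1) * (p ^ 2 - p) := by
  classical
  have hset : ({M : Matrix (Fin 2) (Fin 2) (ZMod p) | M.det ≠ 0} : Set _) =
      Set.range (Units.val : GL (Fin 2) (ZMod p) → Matrix (Fin 2) (Fin 2) (ZMod p)) := by
    ext M
    simp only [Set.mem_setOf_eq, Set.mem_range]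
    constructor
    · intro h
      have hu : IsUnit M := (Matrix.isUnit_iff_isUnit_det M).mpr (isUnit_iff_ne_zero.mpr h)
      exact ⟨hu.unit, hu.unit_spec⟩
    · rintro ⟨u, rfl⟩
      exact ((Matrix.isUnit_iff_isUnit_det _).mp u.isUnit).ne_zero
  rw [hset, ← Nat.card_coe_set_eq, Nat.card_range_of_injective Units.val_injective,
    Matrix.card_GL_field, ZMod.card, Fin.prod_univ_two]
  simp

/-- **`|O₍ₚ₎ˣ mod p O₍ₚ₎| = |GL₂(𝔽_p)| = (p² - 1)(p² - p)` at a split prime** (Vignéras II §2: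
`O_p ≅ M₂(ℤ_p)`, so `O_p / p O_p ≅ M₂(𝔽_p)` and the units reduce onto `GL₂(𝔽_p)`; the
reduction of the model `Ψ` is surjective by density and a unit determinant lifts to a unit of
`O₍ₚ₎`). [cite: VignerasLNM800, Ch. II §2 Thm. 2.3] -/
theorem ncard_image_stabilizer_of_split (hdiv : ∀ x : B, x ≠ 0 → IsUnit x)
    (Ψ : B →ₐ[ℚ] Matrix (Fin 2) (Fin 2) ℚ_[p]) {O : Submodule ℤ B} (hO : IsZOrder O)
    (hΛ : ∀ x : B, x ∈ localAt p O ↔ ∀ i j, ‖Ψ x i j‖ ≤ 1) :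
    (QuotientAddGroup.mk '' (Units.val '' (MulAction.stabilizer Bˣ (localAt p O) : Set Bˣ)) :
      Set (B ⧸ (((p : ℤ) ^ 1) • localAt p O).toAddSubgroup)).ncard = (p ^ 2 - 1) * (p ^ 2 - p) := by
  classical
  have hpp : p.Prime := hp.out
  have hp0 : (p : ℚ_[p]) ≠ 0 := Nat.cast_ne_zero.mpr hpp.ne_zero
  have hpQ : (p : ℚ) ≠ 0 := Nat.cast_ne_zero.mpr hpp.ne_zero
  haveI : Nontrivial B := Module.nontrivial_of_finrank_pos (R := ℚ)
    (by rw [IsQuaternionAlgebra.finrank_eq_four (K := ℚ) (D := B)]; norm_num)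
  -- the reduction map
  let ρ : B → Matrix (Fin 2) (Fin 2) (ZMod p) := fun x =>
    Matrix.of fun i j => if h : ‖Ψ x i j‖ ≤ 1 then PadicInt.toZMod ⟨Ψ x i j, h⟩ else 0
  have hρ : ∀ {x : B} (hx : ∀ i j, ‖Ψ x i j‖ ≤ 1) (i j : Fin 2),
      ρ x i j = PadicInt.toZMod ⟨Ψ x i j, hx i j⟩ := fun hx i j => by
    simp only [ρ, Matrix.of_apply, dif_pos (hx i j)]
  -- integral lift of `Ψ x` and the determinant
  let ΨZ : ∀ (x : B), (∀ i j, ‖Ψ x i j‖ ≤ 1) → Matrix (Fin 2) (Fin 2) ℤ_[p] := fun x hx =>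
    Matrix.of fun i j => ⟨Ψ x i j, hx i j⟩
  have hρZ : ∀ {x : B} (hx : ∀ i j, ‖Ψ x i j‖ ≤ 1), ρ x = (PadicInt.toZMod).mapMatrix (ΨZ x hx) := by
    intro x hx; ext i j; rw [hρ hx, RingHom.mapMatrix_apply, Matrix.map_apply]; rfl
  have hΨZcoe : ∀ {x : B} (hx : ∀ i j, ‖Ψ x i j‖ ≤ 1),
      (PadicInt.Coe.ringHom (p := p)).mapMatrix (ΨZ x hx) = Ψ x := by
    intro x hx; ext i j; rfl
  have hρdet : ∀ {x : B} (hx : ∀ i j, ‖Ψ x i j‖ ≤ 1), (ρ x).det = PadicInt.toZMod (ΨZ x hx).det := by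
    intro x hx; rw [hρZ hx, ← RingHom.map_det]
  have hnormdet : ∀ {x : B} (hx : ∀ i j, ‖Ψ x i j‖ ≤ 1), ‖(ΨZ x hx).det‖ = ‖(Ψ x).det‖ := by
    intro x hx
    rw [PadicInt.norm_def, show ((ΨZ x hx).det : ℚ_[p]) = PadicInt.Coe.ringHom (ΨZ x hx).det from rfl,
      RingHom.map_det, hΨZcoe hx]
  set G : Set B := Units.val '' (MulAction.stabilizer Bˣ (localAt p O) : Set Bˣ) with hG
  set K : Submodule ℤ B := ((p : ℤ) ^ 1) • localAt p O with hK
  have hGΛ : ∀ x ∈ G, ∀ i j, ‖Ψ x i j‖ ≤ 1 := by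
    rintro _ ⟨u, hu, rfl⟩
    exact (hΛ _).mp (hO.mem_stabilizer_localAt_iff.mp hu).1
  -- (K1) same fibres as reduction modulo `p O₍ₚ₎`
  have hfib : ∀ x ∈ G, ∀ y ∈ G, ((QuotientAddGroup.mk x : B ⧸ K.toAddSubgroup) = QuotientAddGroup.mk y
      ↔ ρ x = ρ y) := by
    intro x hx y hy
    have hx' := hGΛ x hx
    have hy' := hGΛ y hy
    rw [QuotientAddGroup.eq]
    change -x + y ∈ K ↔ _
    have hmem : -x + y ∈ K ↔ ∀ i j, ‖Ψ (y - x) i j‖ ≤ (p : ℝ)⁻¹ := by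
      rw [hK, pow_one]
      constructor
      · intro h
        obtain ⟨w, hw, hwe⟩ := (Submodule.mem_smul_pointwise_iff_exists _ _ _).mp h
        have hw' := (hΛ w).mp hw
        intro i j
        have : y - x = (p : ℚ) • w := by
          rw [sub_eq_neg_add, ← hwe, natCast_zsmul_eq_ratCast_smul]
        rw [this, map_smul, Matrix.smul_apply, ← IsScalarTower.algebraMap_smul ℚ_[p] (p : ℚ) (Ψ w i j),
          smul_eq_mul, norm_mul]
        change ‖((p : ℚ) : ℚ_[p])‖ * _ ≤ _
        rw [Rat.cast_natCast, Padic.norm_p]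
        exact mul_le_of_le_one_right (inv_nonneg.mpr (Nat.cast_nonneg _)) (hw' i j)
      · intro h
        refine (Submodule.mem_smul_pointwise_iff_exists _ _ _).mpr ⟨(p : ℚ)⁻¹ • (y - x), ?_, ?_⟩
        · rw [hΛ]
          intro i j
          rw [map_smul, Matrix.smul_apply, ← IsScalarTower.algebraMap_smul ℚ_[p] ((p : ℚ)⁻¹) (Ψ (y - x) i j),
            smul_eq_mul, norm_mul]
          change ‖(((p : ℚ)⁻¹ : ℚ) : ℚ_[p])‖ * _ ≤ 1
          rw [Rat.cast_inv, Rat.cast_natCast, norm_inv, Padic.norm_p, inv_inv]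
          calc (p : ℝ) * ‖Ψ (y - x) i j‖ ≤ (p : ℝ) * (p : ℝ)⁻¹ :=
                mul_le_mul_of_nonneg_left (h i j) (Nat.cast_nonneg _)
            _ = 1 := mul_inv_cancel₀ (by exact_mod_cast hpp.ne_zero)
        · rw [natCast_zsmul_eq_ratCast_smul, smul_smul, mul_inv_cancel₀ hpQ, one_smul, sub_eq_neg_add]
    rw [hmem]
    constructor
    · intro h
      ext i j
      rw [hρ hx', hρ hy', PadicInt.toZMod_eq_toZMod_iff, PadicInt.norm_lt_one_iff_norm_le_inv]
      have : ‖(⟨Ψ x i j, hx' i j⟩ - ⟨Ψ y i j, hy' i j⟩ : ℤ_[p])‖ = ‖Ψ (y - x) i j‖ := by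
        rw [map_sub, Matrix.sub_apply, ← norm_neg (Ψ y i j - Ψ x i j), neg_sub]; rfl
      rw [this]; exact h i j
    · intro h i j
      have hij := congr_fun (congr_fun h i) j
      rw [hρ hx', hρ hy', PadicInt.toZMod_eq_toZMod_iff, PadicInt.norm_lt_one_iff_norm_le_inv] at hij
      have : ‖(⟨Ψ x i j, hx' i j⟩ - ⟨Ψ y i j, hy' i j⟩ : ℤ_[p])‖ = ‖Ψ (y - x) i j‖ := by
        rw [map_sub, Matrix.sub_apply, ← norm_neg (Ψ y i j - Ψ x i j), neg_sub]; rfl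
      rw [this] at hij; exact hij
  -- (K2) the image of the units is `{det ≠ 0}`
  have himage : ρ '' G = {M : Matrix (Fin 2) (Fin 2) (ZMod p) | M.det ≠ 0} := by
    ext M
    simp only [Set.mem_image, Set.mem_setOf_eq]
    constructor
    · rintro ⟨x, hx, rfl⟩
      obtain ⟨u, hu, rfl⟩ := hx
      have hu' := hO.mem_stabilizer_localAt_iff.mp hu
      have h1 : ∀ i j, ‖Ψ (u : B) i j‖ ≤ 1 := (hΛ _).mp hu'.1
      have h2 : ∀ i j, ‖Ψ ((u⁻¹ : Bˣ) : B) i j‖ ≤ 1 := (hΛ _).mp hu'.2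
      have hGL : Ψ (u : B) ∈ padicGL2 p := by
        refine mem_padicGL2_of_inv h1 ((Matrix.isUnit_iff_isUnit_det _).mp ((Units.isUnit u).map Ψ)) ?_
        rw [← algHom_units_inv Ψ u]
        exact h2
      rw [hρdet h1, Ne, PadicInt.toZMod_eq_zero_iff, not_lt, hnormdet h1]
      exact le_of_eq hGL.2.symm
    · intro hM
      -- lift `M` and approximate
      let Mt : Matrix (Fin 2) (Fin 2) ℚ_[p] := fun i j => ((M i j).val : ℚ_[p])
      obtain ⟨b, hb⟩ := AlgHom.exists_norm_sub_le Ψ Mt 1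
      have hp1 : (p : ℝ) ^ (-((1 : ℕ) : ℤ)) < 1 :=
        zpow_lt_one_of_neg₀ (by exact_mod_cast hpp.one_lt) (by norm_num)
      have hMt : ∀ i j, ‖Mt i j‖ ≤ 1 := fun i j => IsUltrametricDist.norm_natCast_le_one ℚ_[p] _
      have hbint : ∀ i j, ‖Ψ b i j‖ ≤ 1 := by
        intro i j
        have : Ψ b i j = Mt i j + (Ψ b - Mt) i j := by rw [Matrix.sub_apply]; ring
        rw [this]
        exact (Padic.nonarchimedean _ _).trans (max_le (hMt i j) ((hb i j).trans hp1.le))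
      have hρb : ρ b = M := by
        ext i j
        have hcong : PadicInt.toZMod (⟨Ψ b i j, hbint i j⟩ : ℤ_[p]) = PadicInt.toZMod ((M i j).val : ℤ_[p]) := by
          rw [PadicInt.toZMod_eq_toZMod_iff, PadicInt.norm_def, PadicInt.coe_sub, PadicInt.coe_natCast]
          exact lt_of_le_of_lt (hb i j) hp1
        rw [hρ hbint, hcong, map_natCast, ZMod.natCast_zmod_val]
      -- `det Ψ b` is a unit, so `b` is a unit of `O₍ₚ₎`
      have hdet1 : ‖(Ψ b).det‖ = 1 := by
        refine le_antisymm (norm_det_fin_two_le_one hbint) (not_lt.mp fun hlt => hM ?_)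
        rw [← hρb, hρdet hbint, PadicInt.toZMod_eq_zero_iff, hnormdet hbint]
        exact hlt
      have hb0 : b ≠ 0 := by
        intro h; rw [h, map_zero, Matrix.det_zero, norm_zero] at hdet1; exact zero_ne_one hdet1
      set ub := (hdiv b hb0).unit with hub
      have hubv : (ub : B) = b := IsUnit.unit_spec _
      have hGLb : Ψ b ∈ padicGL2 p := ⟨hbint, hdet1⟩
      have hinv : ∀ i j, ‖Ψ ((ub⁻¹ : Bˣ) : B) i j‖ ≤ 1 := by
        rw [algHom_units_inv Ψ, hubv]
        exact (inv_mem_padicGL2 hGLb).1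
      refine ⟨b, ⟨ub, hO.mem_stabilizer_localAt_iff.mpr ⟨?_, (hΛ _).mpr hinv⟩, hubv⟩, hρb⟩
      rw [hubv]; exact (hΛ b).mpr hbint
  rw [ncard_image_mk_eq_ncard_image ρ hfib, himage, ncard_det_ne_zero_zmod]

end UnitCount

/-! ### The density of the norm-level complement at a split prime tends to `0` -/

section Density

variable {B : Type u} [Ring B] [Algebra ℚ B] [IsQuaternionAlgebra ℚ B] {p : ℕ} [hp : Fact p.Prime]

omit hp in
/-- **`∑_k σ₁(p^k) p^{-2k} = p⁴ / ((p² - 1)(p² - p))`** (`= 1/((1 - p⁻¹)(1 - p⁻²))`, the local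
factor `ζ_p(2s) ζ_p(2s - 1)` at `s = 1`), for any real `p > 1`, via
`σ₁(p^k) p^{-2k} = (r^k - r^{2k+1})/(1 - r)`, `r = p⁻¹`. [folklore] -/
theorem hasSum_sigma_one_div_pow {q : ℝ} (hq : 1 < q) :
    HasSum (fun k : ℕ => (∑ i ∈ range (k + 1), q ^ i) / q ^ (2 * k))
      (q ^ 4 / ((q ^ 2 - 1) * (q ^ 2 - q))) := by
  have hq0 : 0 < q := by linarith
  set r : ℝ := q⁻¹ with hr
  have hr0 : 0 ≤ r := inv_nonneg.mpr hq0.le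
  have hr1 : r < 1 := inv_lt_one_of_one_lt₀ hq
  have hr1' : 1 - r ≠ 0 := by linarith
  -- the terms
  have hq1 : q - 1 ≠ 0 := by linarith
  have hterm : ∀ k : ℕ, (∑ i ∈ range (k + 1), q ^ i) / q ^ (2 * k) = (r ^ k - r * (r ^ 2) ^ k) / (1 - r) := by
    intro k
    have hgeom : ∑ i ∈ range (k + 1), q ^ i = (q ^ (k + 1) - 1) / (q - 1) := geom_sum_eq hq.ne' (k + 1)
    rw [hgeom, hr]
    simp only [inv_pow, ← pow_mul]
    field_simp
    ring
  simp_rw [hterm]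
  have h1 : HasSum (fun k : ℕ => r ^ k) (1 - r)⁻¹ := hasSum_geometric_of_lt_one hr0 hr1
  have h2 : HasSum (fun k : ℕ => r * (r ^ 2) ^ k) (r * (1 - r ^ 2)⁻¹) :=
    (hasSum_geometric_of_lt_one (sq_nonneg r) (by nlinarith)).mul_left r
  have h3 : HasSum (fun k : ℕ => (r ^ k - r * (r ^ 2) ^ k) / (1 - r))
      (((1 - r)⁻¹ - r * (1 - r ^ 2)⁻¹) / (1 - r)) := (h1.sub h2).div_const (1 - r)
  have hq1' : q + 1 ≠ 0 := by linarith
  have hq2 : q ^ 2 - 1 ≠ 0 := by nlinarith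
  have hq3 : q ^ 2 - q ≠ 0 := by nlinarith
  have hval : q ^ 4 / ((q ^ 2 - 1) * (q ^ 2 - q)) = ((1 - r)⁻¹ - r * (1 - r ^ 2)⁻¹) / (1 - r) := by
    rw [hr]
    field_simp
    ring
  rw [hval]
  exact h3

/-- **At a split prime the density `|Y_R mod p^R O₍ₚ₎| / p^{4R}` of the complement `Y_R` of the
norm levels `X_k`, `k < R`, tends to `0`**: it equals `1 - (u_p / p⁴) ∑_{k<R} a(p^k) p^{-2k}` with
`u_p = |GL₂(𝔽_p)|` and `a(p^k) = σ₁(p^k)`, and `∑_k σ₁(p^k) p^{-2k} = p⁴ / u_p`. [cite: Voight2021, §26.4 and Lemma 26.6.7] -/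
theorem tendsto_density_normLevel_compl_of_split (hdiv : ∀ x : B, x ≠ 0 → IsUnit x)
    (Ψ : B →ₐ[ℚ] Matrix (Fin 2) (Fin 2) ℚ_[p]) {O : Submodule ℤ B} (hO : IsZOrder O)
    (hΛ : ∀ x : B, x ∈ localAt p O ↔ ∀ i j, ‖Ψ x i j‖ ≤ 1) :
    Tendsto (fun R : ℕ => ((QuotientAddGroup.mk '' ((localAt p O : Set B) \ ⋃ k ∈ range R,
        Units.val '' normLevelUnits p O k) :
      Set (B ⧸ (((p : ℤ) ^ R) • localAt p O).toAddSubgroup)).ncard : ℝ) / (p : ℝ) ^ (4 * R))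
      atTop (𝓝 0) := by
  classical
  have hpp : p.Prime := hp.out
  have hpR : (0 : ℝ) < p := by exact_mod_cast hpp.pos
  have hp1 : (1 : ℝ) < p := by exact_mod_cast hpp.one_lt
  set u : ℕ := (QuotientAddGroup.mk '' (Units.val '' (MulAction.stabilizer Bˣ (localAt p O) : Set Bˣ)) :
      Set (B ⧸ (((p : ℤ) ^ 1) • localAt p O).toAddSubgroup)).ncard with hu
  have huval : u = (p ^ 2 - 1) * (p ^ 2 - p) := ncard_image_stabilizer_of_split hdiv Ψ hO hΛ
  have hureal : (u : ℝ) = ((p : ℝ) ^ 2 - 1) * ((p : ℝ) ^ 2 - p) := by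
    rw [huval]
    have h1 : 1 ≤ p ^ 2 := Nat.one_le_pow _ _ hpp.pos
    have h2 : p ≤ p ^ 2 := by nlinarith [hpp.one_lt]
    push_cast [Nat.cast_sub h1, Nat.cast_sub h2]
    ring
  have hu0 : (0 : ℝ) < u := by exact_mod_cast hO.ncard_image_stabilizer_pos
  -- the partial sums of the local factor
  set S : ℕ → ℝ := fun R => ∑ k ∈ range R, (Nat.card {N : Submodule ℤ B // (∃ z : Bˣ, (z : B) ∈ localAt p O ∧
      N = z • localAt p O) ∧ N.toAddSubgroup.relIndex (localAt p O).toAddSubgroup = p ^ (2 * k)} : ℝ) /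
      (p : ℝ) ^ (2 * k) with hS
  have hSeq : ∀ R, S R = ∑ k ∈ range R, (∑ i ∈ range (k + 1), (p : ℝ) ^ i) / (p : ℝ) ^ (2 * k) := by
    intro R
    refine Finset.sum_congr rfl fun k _ => ?_
    rw [card_principal_ideals_of_split hdiv Ψ hO hΛ k]
    push_cast
    rfl
  have hSlim : Tendsto S atTop (𝓝 ((p : ℝ) ^ 4 / u)) := by
    have h := (hasSum_sigma_one_div_pow hp1).tendsto_sum_nat
    rw [hureal]
    refine h.congr fun R => (hSeq R).symm
  -- the identity `density = 1 - (u/p⁴) S_R` for `R ≥ 1`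
  set D : ℕ → ℝ := fun R => ((QuotientAddGroup.mk '' ((localAt p O : Set B) \ ⋃ k ∈ range R,
        Units.val '' normLevelUnits p O k) :
      Set (B ⧸ (((p : ℤ) ^ R) • localAt p O).toAddSubgroup)).ncard : ℝ) / (p : ℝ) ^ (4 * R) with hD
  have hident : ∀ R : ℕ, 1 ≤ R → D R = 1 - (u : ℝ) / (p : ℝ) ^ 4 * S R := by
    intro R hR
    have h : S R = (p : ℝ) ^ 4 / u * (1 - D R) := hO.sum_range_card_principal_div_eq (p := p) hR
    have hp4 : (p : ℝ) ^ 4 ≠ 0 := pow_ne_zero _ hpR.ne'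
    rw [h]
    field_simp
    ring
  have hlim : Tendsto (fun R : ℕ => 1 - (u : ℝ) / (p : ℝ) ^ 4 * S R) atTop (𝓝 0) := by
    have h := (hSlim.const_mul ((u : ℝ) / (p : ℝ) ^ 4)).const_sub 1
    have hval : (1 : ℝ) - (u : ℝ) / (p : ℝ) ^ 4 * ((p : ℝ) ^ 4 / u) = 0 := by
      field_simp; ring
    rwa [hval] at h
  change Tendsto D atTop (𝓝 0)
  refine (tendsto_congr' ?_).mpr hlim
  filter_upwards [eventually_ge_atTop 1] with R hR
  exact hident R hR

end Density

end Literature.NumberTheory.Automorphic
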